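import Summits.BirchSwinnertonDyer.Rank1Residual.WAll.TargetAdditiveAtThreeCells
import Literature.NumberTheory.EllipticCurves.QuadraticTwist
import Literature.NumberTheory.DiophantineGeometry.LocalReduction
import HarnessLib

set_option linter.dupNamespace false

noncomputable section

open scoped Classical

open WeierstrassCurve Literature.NumberTheory.EllipticCurves
  Literature.NumberTheory.EllipticCurves.Rank1Residual IsDedekindDomain NumberField

/-! BC3 birth skeleton for crux `TprimeRankOneUpperAtThree` (route TameQuarticSolvent): the regime split
by the mod-3 image — onto rows (Kolyvagin + Jetchev's Σ-form at p = 3; 731 census classes) and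
small-image rows (normaliser 97 + reducible 2 705 classes; no printed bound) — and the composition. -/

namespace Summit.BirchSwinnertonDyer.BirchSwinnertonDyer.Theses.TameQuarticSolvent

/-- crux (rank 2, deciding): SOLVENT PAIR LOWER BOUND. For a non-CM (t′)-at-3 curve of analytic rank 1
there is a real-quadratic, 3-ramified quadratic twist `E^{(d)}` (`d > 0`, `v₃(d) = 1`, again (t′) at 3)
of analytic rank 0 such that the 3-adic BSD defects of the PAIR satisfy
`ord₃ Ш_an(E) + ord₃ Ш_an(E^{(d)}) ≤ ord₃ #Ш(E) + ord₃ #Ш(E^{(d)})` — the ℚ-shadow of exact BSD₃ for E over a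
totally real tame quartic solvent field `L″ ⊃ ℚ(√d)` at whose place over 3 the curve has GOOD supersingular
reduction, minus Kolyvagin's upper bound for the complementary `ℚ(√d)`-component. -/
def SolventPairLowerBound : Prop :=
  ∀ (W : WeierstrassCurve ℚ) [W.IsElliptic] [W.IsGloballyMinimal],
    ¬ W.HasCM → Addv W 3 → Summit.BirchSwinnertonDyer.Rank1Residual.Additive.SubTprime W 3 → W.analyticRank = 1 →
    ∃ (d : ℤ) (Wd : WeierstrassCurve ℚ) (_ : Wd.IsElliptic) (_ : Wd.IsGloballyMinimal),
      0 < d ∧ padicValInt 3 d = 1 ∧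
      (∃ C : WeierstrassCurve.VariableChange ℚ, C • W.quadraticTwist (d : ℚ) = Wd) ∧
      ¬ Wd.HasCM ∧ Addv Wd 3 ∧ Summit.BirchSwinnertonDyer.Rank1Residual.Additive.SubTprime Wd 3 ∧ Wd.analyticRank = 0 ∧
      ∃ q q' : ℚ, shaAn W = (q : ℂ) ∧ shaAn Wd = (q' : ℂ) ∧
        padicValRat 3 q + padicValRat 3 q' ≤
          (padicValNat 3 W.shaOrder : ℤ) + (padicValNat 3 Wd.shaOrder : ℤ)

/-- crux (rank 3): the Heegner-side (Euler-system) UPPER half `ord₃ #Ш(E) ≤ ord₃ Ш_an(E)` on the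
non-CM (t′)-at-3 rows of analytic rank 1. -/
def TprimeRankOneUpperAtThree : Prop :=
  ∀ (W : WeierstrassCurve ℚ) [W.IsElliptic] [W.IsGloballyMinimal],
    ¬ W.HasCM → Addv W 3 → Summit.BirchSwinnertonDyer.Rank1Residual.Additive.SubTprime W 3 → W.analyticRank = 1 →
    Typed.MissingUpperBoundAt W 3

/-- crux (rank 4): the Kato-side UPPER half `ord₃ #Ш(E) ≤ ord₃ Ш_an(E)` on the non-CM (t′)-at-3 rows of
analytic rank 0 (Kato 14.5 (3) on the (12.5.2) rows; route KT's U₀ items elsewhere). -/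
def TprimeRankZeroUpperAtThree : Prop :=
  ∀ (W : WeierstrassCurve ℚ) [W.IsElliptic] [W.IsGloballyMinimal],
    ¬ W.HasCM → Addv W 3 → Summit.BirchSwinnertonDyer.Rank1Residual.Additive.SubTprime W 3 → W.analyticRank = 0 →
    Typed.MissingUpperBoundAt W 3

/-- support (rank 9): published input — Gross–Zagier–Kolyvagin `rank = r_an`, `Ш` finite in analytic
rank ≤ 1 (tree named fact, by name). -/
def PublishedInputGZK : Prop :=
  rank_eq_analyticRank_of_analyticRank_le_one

end Summit.BirchSwinnertonDyer.BirchSwinnertonDyer.Theses.TameQuarticSolvent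

namespace Summit.BirchSwinnertonDyer.BirchSwinnertonDyer.Cruxes.TprimeRankOneUpperAtThree.Birth

/-- Stub 1 (L): the upper half on the ONTO rows — ρ̄_(E,3) surjective: Kolyvagin's bound
ord₃ #Ш(E/K) ≤ 2·ord₃[E(K):ℤy_K] read with Jetchev's exact Σ-form at the additive prime 3 (c₃ = 2,
Manin constant kept) and descended to ℚ via a Friedberg–Hoffstein field with L(E^(D),1) ≠ 0. -/
def StubOntoRows : Prop :=
  ∀ (W : WeierstrassCurve ℚ) [W.IsElliptic] [W.IsGloballyMinimal],
    ¬ W.HasCM → Addv W 3 → Summit.BirchSwinnertonDyer.Rank1Residual.Additive.SubTprime W 3 → W.analyticRank = 1 →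
    W.HasSurjectiveModNGaloisRep 3 → Typed.MissingUpperBoundAt W 3

theorem stub_ontoRows : StubOntoRows := by
  sorry

/-- Stub 2 (XL): the upper half on the SMALL-IMAGE rows — ρ̄_(E,3) not surjective (normaliser of a
Cartan, or reducible = rational 3-isogeny): no Kolyvagin bound in print; Kato-type or
isogeny-invariance-plus-partner arguments. -/
def StubSmallImageRows : Prop :=
  ∀ (W : WeierstrassCurve ℚ) [W.IsElliptic] [W.IsGloballyMinimal],
    ¬ W.HasCM → Addv W 3 → Summit.BirchSwinnertonDyer.Rank1Residual.Additive.SubTprime W 3 → W.analyticRank = 1 →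
    ¬ W.HasSurjectiveModNGaloisRep 3 → Typed.MissingUpperBoundAt W 3

theorem stub_smallImageRows : StubSmallImageRows := by
  sorry

/-- The route crux, by name (reducible alias so that exactly ONE theorem of this file — `TprimeRankOneUpperAtThree_holds_of_stubs` —
has the crux constant as its conclusion head; `TprimeRankOneUpperAtThree_of` is the kernel-checked composition). -/
abbrev Goal : Prop := Summit.BirchSwinnertonDyer.BirchSwinnertonDyer.Theses.TameQuarticSolvent.TprimeRankOneUpperAtThree

theorem TprimeRankOneUpperAtThree_of :
    StubOntoRows → StubSmallImageRows → Goal := by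
  intro h1 h2 W _ _ hCM hadd hsub hr
  by_cases himg : W.HasSurjectiveModNGaloisRep 3
  · exact h1 W hCM hadd hsub hr himg
  · exact h2 W hCM hadd hsub hr himg

theorem TprimeRankOneUpperAtThree_holds_of_stubs : Summit.BirchSwinnertonDyer.BirchSwinnertonDyer.Theses.TameQuarticSolvent.TprimeRankOneUpperAtThree :=
  TprimeRankOneUpperAtThree_of stub_ontoRows stub_smallImageRows

end Summit.BirchSwinnertonDyer.BirchSwinnertonDyer.Cruxes.TprimeRankOneUpperAtThree.Birth

end
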